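import Literature.NumberTheory.Transcendental.PhilipponZeroEstimateLoc
import Literature.AlgebraicGeometry.Resolution.CohenMacaulayAvoidance
import Mathlib.RingTheory.RegularLocalRing.Polynomial
import HarnessLib

/-!
# Philippon's zero estimate on `𝔾ₐ × 𝔾ₘ^n`: non-zero-divisors from the Cohen–Macaulay property

Topic `Literature/NumberTheory/Transcendental`. Ninth module of the inline discharge of
`Literature.NumberTheory.Transcendental.Philippon1986_GaGm`. Roy's Prop. 2.2 (LNM 1752, Ch. 11,
pp. 202–204) cuts `G` by successive generic members `Q₁, Q₂, …` of the linear system generating the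
special ideal and needs each `Q_{j+1}` to be a non-zero-divisor modulo `(Q₁, …, Q_j)` *locally at the
points of `G`* — the printed proof invokes the non-singularity of `G`, Krull's theorem and
I. S. Cohen's unmixedness theorem in the regular local rings `ℂ[X]_M`. Here, for
`B = ℂ[X, Y₁, …, Y_n]` and a prime `𝔭`, we PROVE the form used by the multiplicity estimate:

* **`isNZDMod_loc_ofList`** — if `Q₁, …, Q_k ∈ 𝔭` and each `Q_{l+1}` lies outside every minimal
  prime `𝔭' ⊆ 𝔭` of `(Q₁, …, Q_l)`, then `Q_{l+1}` is a non-zero-divisor modulo the component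
  `GaGm.loc 𝔭 (Q₁, …, Q_l)` (`…Loc.lean`). Proof: `B_𝔭` is a regular local ring
  (`MvPolynomial.isRegularRing_of_isRegularRing`), hence Cohen–Macaulay
  (`exists_isRegular_length_eq_ringKrullDim`), so `Q` is `B_𝔭`-regular by
  `isRegular_of_forall_notMem_minimalPrimes` (`CohenMacaulayAvoidance.lean`), the avoidance
  hypothesis passing to `B_𝔭` through `IsLocalization.minimalPrimes_map`; regularity in `B_𝔭`
  is exactly the non-zero-divisor property modulo `loc 𝔭`.

## References

* Yu. V. Nesterenko, P. Philippon (eds.), *Introduction to Algebraic Independence Theory*,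
  LNM 1752, Springer 2001, Ch. 11 (D. Roy), Prop. 2.2 (proof, pp. 203–204).
* H. Matsumura, *Commutative Ring Theory*, CUP 1986, Thms. 17.4, 17.8.
-/

noncomputable section

open MvPolynomial IsLocalRing RingTheory.Sequence

namespace Literature.NumberTheory.Transcendental

namespace GaGm

open Literature.AlgebraicGeometry.Resolution

variable {n : ℕ}

/-- Avoidance hypothesis in `B` relative to the prime `𝔭`: each `Q_{l+1}` lies outside every
minimal prime `𝔭' ⊆ 𝔭` of `(Q₁, …, Q_l)`. [folklore] -/
def AvoidsMinimalPrimesBelow (𝔭 : Ideal (MvPolynomial (Fin (n + 1)) ℂ)) (Q : List (MvPolynomial (Fin (n + 1)) ℂ)) :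
    Prop :=
  ∀ (L₁ : List (MvPolynomial (Fin (n + 1)) ℂ)) (q : MvPolynomial (Fin (n + 1)) ℂ)
    (L₂ : List (MvPolynomial (Fin (n + 1)) ℂ)), Q = L₁ ++ q :: L₂ →
    ∀ 𝔭' ∈ (Ideal.ofList L₁).minimalPrimes, 𝔭' ≤ 𝔭 → q ∉ 𝔭'

section AtPrime

variable (𝔭 : Ideal (MvPolynomial (Fin (n + 1)) ℂ)) [h𝔭 : 𝔭.IsPrime]

/-- The avoidance hypothesis passes to the localisation `B_𝔭`. [folklore] -/
theorem avoidsMinimalPrimes_map_atPrime {Q : List (MvPolynomial (Fin (n + 1)) ℂ)} (hav : AvoidsMinimalPrimesBelow 𝔭 Q) :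
    AvoidsMinimalPrimes (Q.map (algebraMap (MvPolynomial (Fin (n + 1)) ℂ) (Localization.AtPrime 𝔭))) := by
  intro M₁ x M₂ hdec 𝔓 h𝔓 hx
  set f := algebraMap (MvPolynomial (Fin (n + 1)) ℂ) (Localization.AtPrime 𝔭) with hf
  obtain ⟨L₁, L, rfl, hL₁, hL⟩ := List.map_eq_append_iff.mp hdec
  obtain ⟨q, L₂, rfl, hq, hL₂⟩ := List.map_eq_cons_iff.mp hL
  have h𝔓p : 𝔓.IsPrime := h𝔓.1.1
  rw [← hL₁, ← Ideal.map_ofList, IsLocalization.minimalPrimes_map 𝔭.primeCompl] at h𝔓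
  -- `𝔓 ∩ B` is a minimal prime of `(L₁)`, it is contained in `𝔭`, and it contains `q`
  have h1 : 𝔓.under (MvPolynomial (Fin (n + 1)) ℂ) ∈ (Ideal.ofList L₁).minimalPrimes := h𝔓
  have hdisj := ((IsLocalization.isPrime_iff_isPrime_disjoint 𝔭.primeCompl (Localization.AtPrime 𝔭) 𝔓).mp
    h𝔓p).2
  have hle : 𝔓.under (MvPolynomial (Fin (n + 1)) ℂ) ≤ 𝔭 := fun y hy => by
    by_contra hy𝔭
    exact Set.disjoint_left.mp hdisj (show y ∈ (𝔭.primeCompl : Set _) from hy𝔭) hy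
  refine hav L₁ q L₂ rfl _ h1 hle ?_
  rw [Ideal.under_def, Ideal.mem_comap, ← hf, hq]
  exact hx

/-- **Non-zero-divisors modulo components from the Cohen–Macaulay property of `B_𝔭`.** If
`Q₁, …, Q_k ∈ 𝔭` and each `Q_{l+1}` avoids the minimal primes `𝔭' ⊆ 𝔭` of `(Q₁, …, Q_l)`, then
`Q_{l+1}` is a non-zero-divisor modulo `loc 𝔭 (Q₁, …, Q_l)`.
[cite: NesterenkoPhilippon2001, Ch. 11 Prop. 2.2 (proof)] -/
theorem isNZDMod_loc_ofList {Q : List (MvPolynomial (Fin (n + 1)) ℂ)} (hQ : ∀ q ∈ Q, q ∈ 𝔭)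
    (hav : AvoidsMinimalPrimesBelow 𝔭 Q) {L₁ : List (MvPolynomial (Fin (n + 1)) ℂ)}
    {q : MvPolynomial (Fin (n + 1)) ℂ} {L₂ : List (MvPolynomial (Fin (n + 1)) ℂ)} (hdec : Q = L₁ ++ q :: L₂) :
    IsNZDMod (loc 𝔭 h𝔭 (Ideal.ofList L₁)) q := by
  set R := Localization.AtPrime 𝔭 with hR
  set f := algebraMap (MvPolynomial (Fin (n + 1)) ℂ) R with hf
  -- `R` is a regular local ring, hence Cohen–Macaulay
  obtain ⟨rs, hrs, hmem, hlen⟩ := exists_isRegular_length_eq_ringKrullDim R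
  have hQm : ∀ x ∈ Q.map f, x ∈ maximalIdeal R := by
    intro x hx
    obtain ⟨q', hq', rfl⟩ := List.mem_map.mp hx
    exact (IsLocalization.AtPrime.to_map_mem_maximal_iff R 𝔭 q').mpr (hQ q' hq')
  have hreg : IsRegular R (Q.map f) :=
    isRegular_of_forall_notMem_minimalPrimes hrs hmem hlen hQm (avoidsMinimalPrimes_map_atPrime 𝔭 hav)
  -- regularity of `f q` on `R ⧸ (L₁)R`
  have hw := hreg.toIsWeaklyRegular
  rw [hdec, List.map_append, List.map_cons, isWeaklyRegular_append_iff, isWeaklyRegular_cons_iff] at hw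
  obtain ⟨-, hsm, -⟩ := hw
  intro g hg
  obtain ⟨P, hP, hPqg⟩ := hg
  set N : Submodule R R := Ideal.ofList (L₁.map f) • ⊤ with hN
  have hNeq : N = (((Ideal.ofList L₁).map f : Ideal R) : Submodule R R) := by
    rw [hN, smul_eq_mul, Ideal.mul_top, Ideal.map_ofList]
  have hx0 : (Submodule.Quotient.mk (f (P * g)) : R ⧸ N) = 0 := by
    refine hsm.right_eq_zero_of_smul ?_
    rw [← Submodule.Quotient.mk_smul, smul_eq_mul, ← map_mul, Submodule.Quotient.mk_eq_zero, hNeq]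
    have e : q * (P * g) = P * (q * g) := by ring
    rw [e]
    exact Ideal.mem_map_of_mem f hPqg
  rw [Submodule.Quotient.mk_eq_zero, hNeq] at hx0
  have hx1 : f (P * g) ∈ (Ideal.ofList L₁).map f := hx0
  rw [hf, IsLocalization.algebraMap_mem_map_algebraMap_iff 𝔭.primeCompl] at hx1
  obtain ⟨m, hm, hmPg⟩ := hx1
  exact ⟨m * P, fun h => (h𝔭.mem_or_mem h).elim hm hP, by rwa [mul_assoc]⟩

end AtPrime

end GaGm

end Literature.NumberTheory.Transcendental
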